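import Summits.CriticalPhenomena.PercolationContinuityZ3.Theorems.PercNearOneGluingNoHeavyLowerTailSahiSlotPatternFace
import Summits.CriticalPhenomena.PercolationContinuityZ3.Theorems.PercNearOneGluingNoHeavyLowerTailSahiAbsorbedHeadBlocks

/-!
# The per-relabelling PROFILE FORMULA: head block expansion of every term of the pattern functional

Support file (lane `prim-masterthm-p3`, generation 18; `--supports stmt-CriticalPhenomena-4575`).  Pure proofs; the only definitions
are the bookkeeping ones of one signed weight (`atomμ`, `atomF`) and the combinatorial complementary factor `blockNcs`; no `sorry`,
standard axioms.

For ANY family `h : Fin (n+1) → X → ℝ` and ANY point assignment `p : Fin (n+1) → X` (for the pattern functional: `X = [n+1]^d`,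
`p_k = τ·diag k`) the representative form `Σ_σ (−1)^{C_σ−1} Π_i h_i(p_{rep σ i})` (`= diagForm d (n+1) (h ∘ τ)`) equals
  `Σ_{S ⊆ [n]} |S|! · ( h_0(p_0) · Π_{j∈S} h_{j+1}(p_0) ) · blockNcs h p ([n] ∖ S)`            (`repSum_eq_sum_powerset`, `diagForm_comp_act_eq_sum_powerset`)
where `blockNcs h p A = Σ_{σ ∈ Sym(A)} (−1)^{C_σ} Π_{O ∈ cycles σ} Π_{j∈O} h_{j+1}(p_{(min O)+1})` is the signed cycle sum of the tail
sub-family `A` read at least elements — a purely combinatorial quantity.  PROOF: the head-ATOM dictionary — a signed weight `atomμ h p`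
on `Option (Finset (Fin (n+1)))` (one atom carrying `h_0(p_0)`, Möbius masses elsewhere) and a family `atomF` (head = indicator of the
atom; tail = `h_i(p_0)` at the atom, coordinate indicators elsewhere) whose joint moments are EXACTLY the block products
`W(O) = Π_{i∈O} h_i(p_{min O})` for every nonempty block (`ex_prod_atomF`), so that `Π_i h_i(p_{rep σ i}) = E_σ` (`prod_rep_eq_cycleE_atom`)
and the representative form is `E_{n+1}^{atomμ}(atomF)`; then the head block expansion for signed weights
`SahiAbsorbed.sahiE_eq …` is not needed in imported form — we expand directly with `sahiE_eq_sum_blocks` through the head slot exactly as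
`…SahiAbsorbedMember` does, and identify the complementary factors with `blockNcs` (`ncs_atom_eq_blockNcs`).
CONSEQUENCES.  (i) The absorbed case (`h_0·h_j = h_0`): all head moments are `h_0(p_0)` and the formula is the `R`-form of the face
theorem.  (ii) **SIGN⁻ skeleton** (`diagForm_single_eq_of_not_mem`): for the profile head `h_0 = 1_{{y}}` and indicator tail with
`y ∉ U_{j₀}`, every `S ∋ j₀` drops out: the `τ`-term of `P_y` is `[p_0 = y] · Σ_{S ⊆ J_y} |S|! · blockNcs(1_U, p, [n]∖S)`, `J_y = {j : y ∈ U_j}`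
— so SIGN⁻ (`P_y ≤ 0` off `∩U_j`) is reduced to `Σ_{τ : τ·0 = y} blockNcs(1_U, τ·diag, A) ≤ 0` for nonempty `A`, i.e. (HIERARCHY §26(j)) to the
lower cells `SlotPatternPos d |A|` via `…SahiSlotPatternRestrict`. [this work]
-/

namespace Summit.CriticalPhenomena.PercolationContinuityZ3.Theorems

open Finset Function Equiv Equiv.Perm
open Literature.Combinatorics.Sahi2008 Literature.Combinatorics.Sahi2008.CycleForm

namespace SahiSlot

section Atom

open scoped Classical

variable {n : ℕ} {X : Type*} (h : Fin (n + 1) → X → ℝ) (p : Fin (n + 1) → X)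

/-- **The head-atom weight**: mass `h_0(p_0)` at the atom, Möbius masses of `W(O) − h_0(p_0)·Π_{i∈O} h_i(p_0)` on the subsets. [this work] -/
noncomputable def atomμ : Option (Finset (Fin (n + 1))) → ℝ
  | none => h 0 (p 0)
  | some S => mobius (fun O => blockW h p O - h 0 (p 0) * ∏ i ∈ O, h i (p 0)) S

/-- **The head-atom family**: the head is the indicator of the atom; member `i ≥ 1` is `h_i(p_0)` at the atom and the coordinate
indicator `[i ∈ S]` on the subsets. [this work] -/
noncomputable def atomF (i : Fin (n + 1)) : Option (Finset (Fin (n + 1))) → ℝ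
  | none => if i = 0 then 1 else h i (p 0)
  | some S => if i = 0 then 0 else if i ∈ S then 1 else 0

/-- On a subset, a block avoiding the head reads `[O ⊆ S]`. [this work] -/
theorem prod_atomF_some {O : Finset (Fin (n + 1))} (hO : (0 : Fin (n + 1)) ∉ O) (S : Finset (Fin (n + 1))) :
    ∏ i ∈ O, atomF h p i (some S) = if O ⊆ S then 1 else 0 := by
  split_ifs with hOS
  · refine prod_eq_one fun i hi => ?_
    have hi0 : i ≠ 0 := fun h0 => hO (h0 ▸ hi)
    simp [atomF, hi0, hOS hi]
  · obtain ⟨i, hiO, hiS⟩ := not_subset.1 hOS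
    have hi0 : i ≠ 0 := fun h0 => hO (h0 ▸ hiO)
    exact prod_eq_zero hiO (by simp [atomF, hi0, hiS])

/-- At the atom, a block avoiding the head reads `Π_{i∈O} h_i(p_0)`. [this work] -/
theorem prod_atomF_none {O : Finset (Fin (n + 1))} (hO : (0 : Fin (n + 1)) ∉ O) :
    ∏ i ∈ O, atomF h p i none = ∏ i ∈ O, h i (p 0) := by
  refine prod_congr rfl fun i hi => ?_
  have hi0 : i ≠ 0 := fun h0 => hO (h0 ▸ hi)
  simp [atomF, hi0]

/-- **Tail moments are block products**: for `0 ∉ O`, `E[Π_{i∈O} atomF i] = W(O)`. [this work] -/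
theorem ex_prod_atomF_tail {O : Finset (Fin (n + 1))} (hO : (0 : Fin (n + 1)) ∉ O) :
    ex (atomμ h p) (fun x => ∏ i ∈ O, atomF h p i x) = blockW h p O := by
  rw [ex_def, Fintype.sum_option]
  have hnone : atomμ h p none * ∏ i ∈ O, atomF h p i none = h 0 (p 0) * ∏ i ∈ O, h i (p 0) := by
    rw [prod_atomF_none h p hO]; rfl
  have hsome : ∑ S : Finset (Fin (n + 1)), atomμ h p (some S) * ∏ i ∈ O, atomF h p i (some S) =
      blockW h p O - h 0 (p 0) * ∏ i ∈ O, h i (p 0) := by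
    simp_rw [prod_atomF_some h p hO, mul_ite, mul_one, mul_zero]
    rw [← sum_filter]
    exact sum_supset_mobius (fun O => blockW h p O - h 0 (p 0) * ∏ i ∈ O, h i (p 0)) O
  rw [hnone, hsome]
  ring

/-- **Head moments**: for `0 ∈ O`, `E[Π_{i∈O} atomF i] = h_0(p_0) · Π_{i∈O∖0} h_i(p_0) = W(O)` (`min O = 0`). [this work] -/
theorem ex_prod_atomF_head {O : Finset (Fin (n + 1))} (hO : (0 : Fin (n + 1)) ∈ O) :
    ex (atomμ h p) (fun x => ∏ i ∈ O, atomF h p i x) = h 0 (p 0) * ∏ i ∈ O.erase 0, h i (p 0) := by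
  rw [ex_def, Fintype.sum_option]
  have hzero : ∀ S : Finset (Fin (n + 1)), ∏ i ∈ O, atomF h p i (some S) = 0 := fun S =>
    prod_eq_zero hO (by simp [atomF])
  simp_rw [hzero, mul_zero, sum_const_zero, add_zero]
  rw [← mul_prod_erase O _ hO, prod_atomF_none h p (O.notMem_erase 0)]
  simp [atomF, atomμ]

/-- Both cases at once: **every nonempty block moment is the block product** `W(O) = Π_{i∈O} h_i(p_{min O})`. [this work] -/
theorem ex_prod_atomF {O : Finset (Fin (n + 1))} (hO : O.Nonempty) :
    ex (atomμ h p) (fun x => ∏ i ∈ O, atomF h p i x) = blockW h p O := by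
  by_cases h0 : (0 : Fin (n + 1)) ∈ O
  · rw [ex_prod_atomF_head h p h0, blockW, dif_pos hO]
    have hmin : O.min' hO = 0 := le_antisymm (Finset.min'_le O 0 h0) (Fin.zero_le _)
    rw [hmin, mul_prod_erase O (fun i => h i (p 0)) h0]
  · exact ex_prod_atomF_tail h p h0

/-- **The cycle product at least-element representatives is `E_σ` under the head-atom weight** (no hypothesis on `h`). [this work] -/
theorem prod_rep_eq_cycleE_atom (σ : Perm (Fin (n + 1))) :
    ∏ i, h i (p (rep σ i)) = cycleE (atomμ h p) (atomF h p) σ := by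
  have hfib : ∏ i, h i (p (rep σ i)) = ∏ j, ∏ i ∈ univ.filter (fun i => rep σ i = j), h i (p j) := by
    rw [← Finset.prod_fiberwise_of_maps_to (g := rep σ) (t := univ) (fun i _ => mem_univ _)]
    refine prod_congr rfl fun j _ => prod_congr rfl fun i hi => ?_
    rw [mem_filter] at hi
    rw [hi.2]
  rw [hfib, ← Finset.prod_filter_mul_prod_filter_not univ (fun j => rep σ j = j)]
  have hnot : ∏ j ∈ univ.filter (fun j => ¬ rep σ j = j), ∏ i ∈ univ.filter (fun i => rep σ i = j), h i (p j) = 1 := by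
    refine prod_eq_one fun j hj => ?_
    rw [mem_filter] at hj
    have hemp : univ.filter (fun i => rep σ i = j) = ∅ := by
      rw [Finset.filter_eq_empty_iff]
      intro i _ h
      exact hj.2 (by rw [← h, rep_rep])
    rw [hemp, prod_empty]
  rw [hnot, mul_one]
  unfold cycleE
  rw [orbits_eq_image_reps, Finset.prod_image (orbit_injOn_reps σ)]
  refine prod_congr rfl fun j hj => ?_
  rw [mem_filter] at hj
  have hfilt : univ.filter (fun i => rep σ i = j) = orbit σ j := by
    ext i
    simp only [mem_filter, mem_univ, true_and, mem_orbit]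
    exact rep_eq_iff hj.2 i
  rw [hfilt, ex_prod_atomF h p ⟨j, self_mem_orbit σ j⟩, blockW, dif_pos ⟨j, self_mem_orbit σ j⟩]
  have hmin : (orbit σ j).min' ⟨j, self_mem_orbit σ j⟩ = j := hj.2
  rw [hmin]

/-- **The representative form is `E_{n+1}` under the head-atom weight** (every `h`, every `p`). [this work] -/
theorem repSum_eq_sahiE_atom :
    ∑ σ : Perm (Fin (n + 1)), (-1 : ℝ) ^ ((orbits σ).card - 1) * ∏ i, h i (p (rep σ i)) =
      sahiE (atomμ h p) (n + 1) (atomF h p) := by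
  simp_rw [prod_rep_eq_cycleE_atom h p]
  rw [sahiE_eq_sahiECycle _ (n + 1) (by omega)]
  rfl

/-! ### The combinatorial complementary factor and the profile formula -/

/-- **The signed cycle sum of a tail sub-family read at least elements**:
`blockNcs h p A = Σ_{σ ∈ Sym(A)} (−1)^{C_σ} Π_{O ∈ cycles σ} W(succ(O))`, `W(succ O) = Π_{j∈O} h_{j+1}(p_{(min O)+1})`; `= 1` for `A = ∅`.
[this work] -/
noncomputable def blockNcs (A : Finset (Fin n)) : ℝ :=
  ∑ σ : Perm {x // x ∈ A}, (-1 : ℝ) ^ (orbits σ).card *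
    ∏ O ∈ orbits σ, blockW h p ((O.map (Embedding.subtype _)).map (Fin.succEmb n))

/-- The tail of the head-atom family, re-indexed by `Fin n`. [this work] -/
theorem atomF_cons : (atomF h p : Fin (n + 1) → Option (Finset (Fin (n + 1))) → ℝ) =
    Fin.cons (atomF h p 0) (fun j => atomF h p j.succ) := by
  funext i
  refine Fin.cases ?_ (fun j => ?_) i
  · rfl
  · simp only [Fin.cons_succ]

/-- **The complementary factors under the head-atom weight are the combinatorial ones**: `ncs(atomF tail)(A) = blockNcs h p A`. [this work] -/
theorem ncs_atom_eq_blockNcs (A : Finset (Fin n)) :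
    SahiAbsorbed.ncs (atomμ h p) (fun j => atomF h p j.succ) A = blockNcs h p A := by
  unfold SahiAbsorbed.ncs blockNcs
  refine sum_congr rfl fun σ _ => ?_
  congr 1
  unfold cycleE
  refine prod_congr rfl fun O hO => ?_
  have hmap : (fun x => ∏ j ∈ O, atomF h p (n := n) (Fin.succ (j : Fin n)) x) =
      fun x => ∏ i ∈ (O.map (Embedding.subtype _)).map (Fin.succEmb n), atomF h p i x := by
    funext x
    rw [prod_map, prod_map]
    rfl
  have hne : ((O.map (Embedding.subtype (· ∈ A))).map (Fin.succEmb n)).Nonempty := by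
    rw [map_nonempty, map_nonempty]
    unfold orbits at hO
    obtain ⟨z, _, rfl⟩ := mem_image.1 hO
    exact ⟨z, self_mem_orbit σ z⟩
  rw [hmap, ex_prod_atomF h p hne]

/-- **Head moments under the head-atom weight**: `E[atomF 0 · Π_{j∈S} atomF (j+1)] = h_0(p_0) · Π_{j∈S} h_{j+1}(p_0)`. [this work] -/
theorem ex_head_prod_atomF (S : Finset (Fin n)) :
    ex (atomμ h p) (fun x => atomF h p 0 x * ∏ j ∈ S, atomF h p j.succ x) = h 0 (p 0) * ∏ j ∈ S, h j.succ (p 0) := by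
  rw [ex_def, Fintype.sum_option]
  have hzero : ∀ T : Finset (Fin (n + 1)), atomF h p 0 (some T) = 0 := fun T => by simp [atomF]
  simp_rw [hzero, zero_mul, mul_zero, sum_const_zero, add_zero]
  have hnone : ∏ j ∈ S, atomF h p (Fin.succ j) none = ∏ j ∈ S, h j.succ (p 0) :=
    prod_congr rfl fun j _ => by simp [atomF, Fin.succ_ne_zero]
  rw [hnone]
  simp [atomF, atomμ]

/-- **THE PROFILE FORMULA (representative form, every `h`, every `p`)**:
`Σ_σ (−1)^{C_σ−1} Π_i h_i(p_{rep σ i}) = Σ_{S ⊆ [n]} |S|! · (h_0(p_0) Π_{j∈S} h_{j+1}(p_0)) · blockNcs h p ([n]∖S)`. [this work] -/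
theorem repSum_eq_sum_powerset :
    ∑ σ : Perm (Fin (n + 1)), (-1 : ℝ) ^ ((orbits σ).card - 1) * ∏ i, h i (p (rep σ i)) =
      ∑ S ∈ (univ : Finset (Fin n)).powerset,
        (S.card.factorial : ℝ) * (h 0 (p 0) * ∏ j ∈ S, h j.succ (p 0)) * blockNcs h p (univ \ S) := by
  rw [repSum_eq_sahiE_atom, atomF_cons, SahiAbsorbed.sahiE_cons_eq_sum_powerset]
  refine sum_congr rfl fun S _ => ?_
  rw [ex_head_prod_atomF, ncs_atom_eq_blockNcs]

end Atom

section Profile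

open scoped Classical

variable {d n : ℕ}

/-- **THE PROFILE FORMULA for the pattern functional**: every term of `patternForm d (n+1) h` expands through the head slot as
`diagForm d (n+1) (h ∘ τ) = Σ_{S ⊆ [n]} |S|! · (h_0(p_0) Π_{j∈S} h_{j+1}(p_0)) · blockNcs h p ([n]∖S)`, `p_k = τ·diag k`. [this work] -/
theorem diagForm_comp_act_eq_sum_powerset (h : Fin (n + 1) → Q d (n + 1) → ℝ) (τ : Fin d → Perm (Fin (n + 1))) :
    diagForm d (n + 1) (fun i => h i ∘ act τ) =
      ∑ S ∈ (univ : Finset (Fin n)).powerset,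
        (S.card.factorial : ℝ) * (h 0 (act τ (diag 0)) * ∏ j ∈ S, h j.succ (act τ (diag 0))) *
          blockNcs h (fun k => act τ (diag k)) (univ \ S) :=
  repSum_eq_sum_powerset h (fun k => act τ (diag k))

/-- **SIGN⁻ skeleton**: for the profile head `1_{{y}}` and an indicator tail with `y ∉ U_{j₀}`, the blocks through `j₀` drop out:
the `τ`-term of `P_y` is `[τ·diag 0 = y] · Σ_{S ⊆ [n], j₀ ∉ S} |S|! · (Π_{j∈S} 1_{U_j}(y)) · blockNcs(…)([n]∖S)`. [this work] -/
theorem diagForm_single_cons_eq (y : Q d (n + 1)) (U : Fin n → Finset (Q d (n + 1))) (j₀ : Fin n) (hy : y ∉ U j₀)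
    (τ : Fin d → Perm (Fin (n + 1))) :
    diagForm d (n + 1) (fun i => (Fin.cons (setInd {y}) (fun j => setInd (U j)) : Fin (n + 1) → Q d (n + 1) → ℝ) i ∘ act τ) =
      ∑ S ∈ (univ : Finset (Fin n)).powerset.filter (fun S => j₀ ∉ S),
        (S.card.factorial : ℝ) * (setInd {y} (act τ (diag 0)) * ∏ j ∈ S, setInd (U j) (act τ (diag 0))) *
          blockNcs (Fin.cons (setInd {y}) (fun j => setInd (U j))) (fun k => act τ (diag k)) (univ \ S) := by
  rw [diagForm_comp_act_eq_sum_powerset, sum_filter]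
  refine sum_congr rfl fun S _ => ?_
  simp only [Fin.cons_zero, Fin.cons_succ]
  split_ifs with hj
  · -- `j₀ ∈ S`: the head moment vanishes unless `τ·diag 0 = y`, and then `1_{U_{j₀}}(y) = 0`
    have hzero : setInd {y} (act τ (diag 0)) * ∏ j ∈ S, setInd (U j) (act τ (diag (d := d) 0)) = 0 := by
      by_cases hp : act τ (diag 0) = y
      · rw [hp, ← mul_prod_erase S _ hj, setInd_apply (U j₀), if_neg hy]
        ring
      · rw [setInd_apply, if_neg (by rwa [mem_singleton]), zero_mul]
    rw [hzero, mul_zero, zero_mul]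
  · rfl

end Profile

end SahiSlot

end Summit.CriticalPhenomena.PercolationContinuityZ3.Theorems
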